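import Summits.HubbardSuperconductivity.HubbardSuperconductivity.Theorems.AnisotropyChordKnnAllN
import Summits.HubbardSuperconductivity.HubbardSuperconductivity.Theorems.AnisotropyChordKnnRatio32

/-!
# Route `AnisotropyChord` / H0 rotor rung, K_{n,n} sibling of XY-LM₀: **THEOREM Q⁺ IN LEAN — `XYLiebMattisKnn n Δ` for
# EVERY `n` and EVERY `Δ ∈ [0, 1]`** (the theory seat's THEOREM Q⁺, memo ROTOR-THEORY-11 §168 / THEOREMS M20, which was
# «a theorem on paper whose every numerical inequality is an exact machine check»; here kernel-checked end to end)
(prover seat `hubbard-h0-rotor-p1` g16)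

Assembly of: THEOREM Q + LEMMA R + (S_M)-assembly (`…KnnAssembly`, g13), the isotropic point (`…KnnIsotropic`), the
ratio-majorant checker for `4 ≤ n ≤ 32` (`…KnnRatio32`) and the analytic ratio-majorant bound for `n ≥ 8` (`…KnnAllN`).
Also LEMMA C for every `n ≥ 4`: the budget condition (S_M) on the whole anisotropy range `0 < η ≤ 1`.
What this is NOT: a statement about the XXZ model on tori (`Tower.TotalSpinMonotone`, XY-LM₀ stays open) or about the
Hubbard model; `Δ < 0` (covered for `n ≤ 32`, `Δ ≥ −4/5` by `…KnnIntervalFull32`) is not treated here.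
-/

set_option linter.dupNamespace false
set_option autoImplicit false

namespace Summit.HubbardSuperconductivity.HubbardSuperconductivity.Theorems.AnisotropyChord.Knn

/-- **LEMMA C (theory seat hubbard-h0-rotor-theory-1, memo §167/§168), Lean, all `n`:** the budget condition (S_M)
`λ_max(P_M(η)) − λ_max(P_{M+1}(η)) ≤ d_{2s−2}(M)` holds for every `n ≥ 4`, every `0 ≤ M ≤ n − 4` and every real
`0 < η ≤ 1`. [conjecture: theory seat hubbard-h0-rotor-theory-1, cycle 12 — LEMMA C; Lean proof here (ratio majorant:
kernel check for `n ≤ 32`, analytic for `n ≥ 8`)] -/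
theorem budgetCondition_all {n M : ℕ} (hM : M + 4 ≤ n) {η : ℝ} (h0 : 0 < η) (h1 : η ≤ 1) : BudgetCondition n M η := by
  by_cases hn : n ≤ 32
  · exact budgetCondition_unit_of_le_32 hn hM h0 h1
  · exact budgetCondition_of_ge_eight (by omega) hM h0 h1

/-- **THEOREM Q⁺ (XY-Lieb–Mattis ordering on every `K_{n,n}`, every `0 ≤ Δ ≤ 1`), Lean.**  For every `n ≥ 1` and every
real `Δ ∈ [0, 1]`, in the two-big-spin Jacobi reduction `P_M(1−Δ)` of the spin-½ XXZ model
`H = −S⃗_A·S⃗_B + (1−Δ) Sᶻ_A Sᶻ_B`-type block on the complete bipartite graph `K_{n,n}` (THEOREMS M12, definitional),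
`⟨S⃗²⟩ = ⟨J(J+1)⟩` of the sector ground states is non-decreasing in `|Sᶻ_tot| = |M|`:  `XYLiebMattisKnn n Δ`.
Ingredients: THEOREM Q (top links, `…KnnTwoLevel`), LEMMA R (`…KnnMLR`), LEMMA C = the budget condition (S_M) for all
`M ≤ n − 4` (`budgetCondition_all`), the isotropic point (`…KnnIsotropic`).  The theory seat's certified family
(`n ≤ 64` tables + `n ≥ 41` Pólya certificates) is superseded by a certificate-light proof: sqrt-free ratio majorant,
one rational evaluation per `(n, M)` for `n ≤ 32`, eleven closed-form polynomial inequalities for `n ≥ 8`.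
Not a statement about tori (XY-LM₀ = `Tower.TotalSpinMonotone 0` stays OPEN) or about the Hubbard model.
[conjecture: theory seat hubbard-h0-rotor-theory-1, cycle 12 — THEOREM Q⁺ (THEOREMS M20); Lean proof here] -/
theorem xyLiebMattisKnn_all (n : ℕ) {Δ : ℝ} (h0 : 0 ≤ Δ) (h1 : Δ ≤ 1) : XYLiebMattisKnn n Δ := by
  by_cases hn : n ≤ 32
  · exact xyLiebMattisKnn_unit_of_le_32 hn h0 h1
  · rcases eq_or_lt_of_le h1 with rfl | hlt
    · exact xyLiebMattisKnn_one n
    · exact xyLiebMattisKnn_of_ge_eight (by omega) h0 hlt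

end Summit.HubbardSuperconductivity.HubbardSuperconductivity.Theorems.AnisotropyChord.Knn
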